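import Summits.ResolutionOfSingularities.ResolutionOfSingularities.Theorems.WeightedInvariantLocalWeightedDropNCDirectrixCutWeierstrass

/-! # W4.3 `LocalWeightedDrop` — directrix cut, order-`p` split: the WEIERSTRASS TRANSPORT `k⟦x_0,…,x_m⟧ ≅ k⟦x_1,…,x_m⟧⟦T⟧`, the `x₀^i`-coefficients
of a Weierstrass-shaped series, and UNIQUENESS OF WEIERSTRASS DIVISION (§§1–3 of res-L1-w43-strat-1's `NCDirectrixCutWeierstrassFactors_tree_v1.lean`)
[OURS · L1 W4.3 · crux stmt-ResolutionOfSingularities-8899 · author res-L1-w43-strat-1 (gen 11), text VERBATIM; filed by res-L1-type-o4 on res-L1-w43-plan-1's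
word (STATUS 2026-08-27T21:27:21Z) as the FIRST HALF of the announced `…NCDirectrixCutWeierstrassFactors.lean` — the 419-line source e5193924e15813f2 is
split in two for the tree's 400-line rule, nothing else changed; `--supports stmt-ResolutionOfSingularities-8899 --as helper`; folklore commutative algebra
over Mathlib (`Mathlib.RingTheory.PowerSeries.WeierstrassPreparation`); nothing of any manuscript; AI-produced, gate-checked, weaker than expert review.]

1. `exists_slotZeroEquiv` / `slotZeroEquiv_spec` (+ `slotZeroEquiv_weierstrassPoly`, `coeff_slotZeroEquiv_weierstrassPoly`) — the transport
   `k⟦x_0, …, x_m⟧ ≅ A⟦T⟧`, `A = k⟦x_1, …, x_m⟧`, `x_0 ↦ T`, packaged DEF-FREE as an existential with its coefficient formula.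
2. `coeff_single_zero_weierstrassPoly`, `constantCoeff_weierstrassPoly` — the `x₀^i`-coefficient of `x₀^o + Σ_{j<o} a_j x₀^j` is `a_i(0)`.
3. `eq_zero_of_weierstrassPoly_dvd` — UNIQUENESS OF WEIERSTRASS DIVISION: if the `a_i(0)` vanish (`h` distinguished) and `h ∣ c` with `c` free of `x₀`,
   then `c = 0` (Mathlib `PowerSeries.IsWeierstrassDivisorAt.eq_zero_of_mul_eq`, transported).
The stubs `T`/`F` and the registered shapes (§§4–6) are in `…NCDirectrixCutWeierstrassFactors`. No definitions, no new axioms. -/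

set_option linter.dupNamespace false -- mandated namespace of this single-conjunct summit

namespace Summit.ResolutionOfSingularities.ResolutionOfSingularities.Theorems

namespace TameFourTupleDrop

open MvPowerSeries Literature.AlgebraicGeometry.Resolution

variable {k : Type} [Field k] {m : ℕ}

/-! ## 1. The transport `k⟦x_0, …, x_m⟧ ≅ k⟦x_1, …, x_m⟧⟦T⟧`, `x_0 ↦ T`, packaged def-free -/

variable (k m) in
/-- The slot-`0` splitting `k⟦x_0, …, x_m⟧ ≃+* A⟦T⟧`, `A = k⟦x_1, …, x_m⟧`, with its coefficient formula and `x_0 ↦ T`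
(`MvPowerSeries.renameEquiv k (finSuccEquiv m)` followed by `Literature.RingTheory.MvPowerSeries.optionEquivLeft`). -/
theorem exists_slotZeroEquiv :
    ∃ e : MvPowerSeries (Fin (m + 1)) k ≃+* PowerSeries (MvPowerSeries (Fin m) k),
      (∀ (G : MvPowerSeries (Fin (m + 1)) k) (i : ℕ) (d : Fin m →₀ ℕ),
          MvPowerSeries.coeff d (PowerSeries.coeff i (e G)) = MvPowerSeries.coeff (Finsupp.cons i d) G) ∧
      e (X 0) = PowerSeries.X := by
  classical
  let e : MvPowerSeries (Fin (m + 1)) k ≃+* PowerSeries (MvPowerSeries (Fin m) k) :=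
    ((MvPowerSeries.renameEquiv k (finSuccEquiv m)).toRingEquiv).trans Literature.RingTheory.MvPowerSeries.optionEquivLeft
  refine ⟨e, fun G i d => ?_, ?_⟩
  · have hidx : Finsupp.optionElim i d = Finsupp.embDomain (finSuccEquiv m).toEmbedding (Finsupp.cons i d) := by
      ext j
      cases j with
      | none =>
          have h0 : (none : Option (Fin m)) = (finSuccEquiv m).toEmbedding 0 := (finSuccEquiv_zero).symm
          rw [h0, Finsupp.embDomain_apply]
          simp [Equiv.toEmbedding_apply, finSuccEquiv_zero]
      | some s =>
          have hs : (some s : Option (Fin m)) = (finSuccEquiv m).toEmbedding s.succ := (finSuccEquiv_succ s).symm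
          rw [hs, Finsupp.embDomain_apply]
          simp [Equiv.toEmbedding_apply, finSuccEquiv_succ]
    show MvPowerSeries.coeff d (PowerSeries.coeff i (Literature.RingTheory.MvPowerSeries.optionEquivLeft
      (MvPowerSeries.renameEquiv k (finSuccEquiv m) G))) = _
    rw [Literature.RingTheory.MvPowerSeries.coeff_coeff_optionEquivLeft, MvPowerSeries.renameEquiv_apply, hidx]
    exact MvPowerSeries.coeff_embDomain_rename (finSuccEquiv m).toEmbedding G (Finsupp.cons i d)
  · show Literature.RingTheory.MvPowerSeries.optionEquivLeft ((MvPowerSeries.renameEquiv k (finSuccEquiv m))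
      (X 0 : MvPowerSeries (Fin (m + 1)) k)) = PowerSeries.X
    show Literature.RingTheory.MvPowerSeries.optionEquivLeft (MvPowerSeries.rename (finSuccEquiv m)
      (X 0 : MvPowerSeries (Fin (m + 1)) k)) = PowerSeries.X
    rw [MvPowerSeries.rename_X, finSuccEquiv_zero]
    exact Literature.RingTheory.MvPowerSeries.optionEquivLeft_X_none

/-- Consequences of the coefficient formula of a slot-`0` splitting `e`: (a) the constant term of the `T^i`-coefficient is the
`x₀^i`-coefficient; (b) a series free of `x₀` goes to the constant `C (…)`; (c) `e⁻¹ (C a)` is free of `x₀`. -/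
theorem slotZeroEquiv_spec {e : MvPowerSeries (Fin (m + 1)) k ≃+* PowerSeries (MvPowerSeries (Fin m) k)}
    (hcoeff : ∀ (G : MvPowerSeries (Fin (m + 1)) k) (i : ℕ) (d : Fin m →₀ ℕ),
      MvPowerSeries.coeff d (PowerSeries.coeff i (e G)) = MvPowerSeries.coeff (Finsupp.cons i d) G) :
    (∀ (G : MvPowerSeries (Fin (m + 1)) k) (i : ℕ),
        MvPowerSeries.constantCoeff (PowerSeries.coeff i (e G)) = coeff (Finsupp.single 0 i) G) ∧
    (∀ G : MvPowerSeries (Fin (m + 1)) k, (∀ n : Fin (m + 1) →₀ ℕ, n 0 ≠ 0 → coeff n G = 0) →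
        e G = PowerSeries.C (PowerSeries.constantCoeff (e G))) ∧
    (∀ (x : MvPowerSeries (Fin m) k) (n : Fin (m + 1) →₀ ℕ), n 0 ≠ 0 → coeff n (e.symm (PowerSeries.C x)) = 0) := by
  refine ⟨fun G i => ?_, fun G hG => ?_, fun x n hn => ?_⟩
  · rw [← MvPowerSeries.coeff_zero_eq_constantCoeff_apply, hcoeff, Finsupp.cons_zero_eq_single_zero]
  · refine PowerSeries.ext fun i => MvPowerSeries.ext fun d => ?_
    by_cases hi : i = 0
    · subst hi
      rw [PowerSeries.coeff_C, if_pos rfl, ← PowerSeries.coeff_zero_eq_constantCoeff_apply]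
    · rw [PowerSeries.coeff_C, if_neg hi, MvPowerSeries.coeff_zero, hcoeff]
      exact hG _ (by rw [Finsupp.cons_zero]; exact hi)
  · have hn' : n = Finsupp.cons (n 0) (Finsupp.tail n) := (Finsupp.cons_tail n).symm
    rw [hn', ← hcoeff, RingEquiv.apply_symm_apply, PowerSeries.coeff_C, if_neg hn, MvPowerSeries.coeff_zero]

/-- The image of a Weierstrass-shaped series `x₀^o + Σ_{i<o} a_i x₀^i` (the `a_i` free of `x₀`) is the honest polynomial
`T^o + Σ_{i<o} C(ā_i) T^i` in `T`. -/
theorem slotZeroEquiv_weierstrassPoly {e : MvPowerSeries (Fin (m + 1)) k ≃+* PowerSeries (MvPowerSeries (Fin m) k)}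
    (hcoeff : ∀ (G : MvPowerSeries (Fin (m + 1)) k) (i : ℕ) (d : Fin m →₀ ℕ),
      MvPowerSeries.coeff d (PowerSeries.coeff i (e G)) = MvPowerSeries.coeff (Finsupp.cons i d) G)
    (heX : e (X 0) = PowerSeries.X) {o : ℕ} (a : ℕ → MvPowerSeries (Fin (m + 1)) k)
    (ha : ∀ i (n : Fin (m + 1) →₀ ℕ), n 0 ≠ 0 → coeff n (a i) = 0) :
    e (X 0 ^ o + ∑ i ∈ Finset.range o, a i * X 0 ^ i) =
      PowerSeries.X ^ o + ∑ i ∈ Finset.range o, PowerSeries.C (PowerSeries.constantCoeff (e (a i))) * PowerSeries.X ^ i := by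
  obtain ⟨-, hC, -⟩ := slotZeroEquiv_spec hcoeff
  rw [map_add, map_pow, heX, map_sum]
  congr 1
  refine Finset.sum_congr rfl fun i _ => ?_
  rw [map_mul, map_pow, heX, ← hC (a i) (ha i)]

/-- The `T`-coefficients of the image of a Weierstrass-shaped series. -/
theorem coeff_slotZeroEquiv_weierstrassPoly {e : MvPowerSeries (Fin (m + 1)) k ≃+* PowerSeries (MvPowerSeries (Fin m) k)}
    (hcoeff : ∀ (G : MvPowerSeries (Fin (m + 1)) k) (i : ℕ) (d : Fin m →₀ ℕ),
      MvPowerSeries.coeff d (PowerSeries.coeff i (e G)) = MvPowerSeries.coeff (Finsupp.cons i d) G)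
    (heX : e (X 0) = PowerSeries.X) {o : ℕ} (a : ℕ → MvPowerSeries (Fin (m + 1)) k)
    (ha : ∀ i (n : Fin (m + 1) →₀ ℕ), n 0 ≠ 0 → coeff n (a i) = 0) (n : ℕ) :
    PowerSeries.coeff n (e (X 0 ^ o + ∑ i ∈ Finset.range o, a i * X 0 ^ i)) =
      (if n = o then 1 else 0) + (if n < o then PowerSeries.constantCoeff (e (a n)) else 0) := by
  classical
  rw [slotZeroEquiv_weierstrassPoly hcoeff heX a ha, map_add, PowerSeries.coeff_X_pow, map_sum]
  congr 1
  rw [Finset.sum_congr rfl fun i _ => PowerSeries.coeff_C_mul_X_pow _ i n, Finset.sum_ite_eq]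
  simp only [Finset.mem_range]

/-! ## 2. The `x₀^i`-coefficients of a Weierstrass-shaped series -/

/-- For `i < o`, the `x₀^i`-coefficient of `x₀^o + Σ_{j<o} a_j x₀^j` is the constant term `a_i(0)`. -/
theorem coeff_single_zero_weierstrassPoly {o : ℕ} (a : ℕ → MvPowerSeries (Fin (m + 1)) k)
    (ha : ∀ i (n : Fin (m + 1) →₀ ℕ), n 0 ≠ 0 → coeff n (a i) = 0) (i : ℕ) (hi : i < o) :
    coeff (Finsupp.single 0 i) (X 0 ^ o + ∑ j ∈ Finset.range o, a j * X 0 ^ j) = constantCoeff (a i) := by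
  obtain ⟨e, hcoeff, heX⟩ := exists_slotZeroEquiv k m
  obtain ⟨hcc, -, -⟩ := slotZeroEquiv_spec hcoeff
  rw [← hcc, coeff_slotZeroEquiv_weierstrassPoly hcoeff heX a ha, if_neg hi.ne, if_pos hi, zero_add,
    ← PowerSeries.coeff_zero_eq_constantCoeff_apply, hcc, Finsupp.single_zero, MvPowerSeries.coeff_zero_eq_constantCoeff_apply]

/-- The constant term of `x₀^o + Σ_{j<o} a_j x₀^j` (`0 < o`) is `a_0(0)`. -/
theorem constantCoeff_weierstrassPoly {o : ℕ} (ho : 0 < o) (a : ℕ → MvPowerSeries (Fin (m + 1)) k)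
    (ha : ∀ i (n : Fin (m + 1) →₀ ℕ), n 0 ≠ 0 → coeff n (a i) = 0) :
    constantCoeff (X 0 ^ o + ∑ j ∈ Finset.range o, a j * X 0 ^ j) = constantCoeff (a 0) := by
  have h := coeff_single_zero_weierstrassPoly a ha 0 ho
  rwa [Finsupp.single_zero, MvPowerSeries.coeff_zero_eq_constantCoeff_apply] at h

/-! ## 3. Uniqueness of Weierstrass division: a distinguished `h` divides no non-zero series free of `x₀` -/

/-- **UNIQUENESS OF WEIERSTRASS DIVISION** (transported Mathlib `PowerSeries.IsWeierstrassDivisorAt.eq_zero_of_mul_eq`): if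
`h = x₀^o + Σ_{i<o} a_i x₀^i` with the `a_i` free of `x₀` and `a_i(0) = 0` (`0 < o`), and `h ∣ c` with `c` free of `x₀`, then `c = 0`. -/
theorem eq_zero_of_weierstrassPoly_dvd {o : ℕ} (ho : 0 < o) (a : ℕ → MvPowerSeries (Fin (m + 1)) k) (c : MvPowerSeries (Fin (m + 1)) k)
    (ha : ∀ i (n : Fin (m + 1) →₀ ℕ), n 0 ≠ 0 → coeff n (a i) = 0) (ha0 : ∀ i < o, constantCoeff (a i) = 0)
    (hc : ∀ n : Fin (m + 1) →₀ ℕ, n 0 ≠ 0 → coeff n c = 0)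
    (hdvd : (X 0 ^ o + ∑ i ∈ Finset.range o, a i * X 0 ^ i) ∣ c) : c = 0 := by
  classical
  let A := MvPowerSeries (Fin m) k
  haveI : IsAdicComplete (IsLocalRing.maximalIdeal A) A := by
    rw [Literature.AlgebraicGeometry.Resolution.maximalIdeal_mvPowerSeries_eq_span]
    infer_instance
  obtain ⟨e, hcoeff, heX⟩ := exists_slotZeroEquiv k m
  obtain ⟨hcc, hC, -⟩ := slotZeroEquiv_spec hcoeff
  obtain ⟨q, hq⟩ := hdvd
  have hgc := coeff_slotZeroEquiv_weierstrassPoly hcoeff heX a ha (o := o)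
  have htop : PowerSeries.coeff o (e (X 0 ^ o + ∑ i ∈ Finset.range o, a i * X 0 ^ i)) = 1 := by
    rw [hgc, if_pos rfl, if_neg (lt_irrefl o), add_zero]
  have hmem : ∀ i < o, PowerSeries.coeff i (e (X 0 ^ o + ∑ i ∈ Finset.range o, a i * X 0 ^ i)) ∈ IsLocalRing.maximalIdeal A := by
    intro i hi
    rw [IsLocalRing.mem_maximalIdeal, mem_nonunits_iff, MvPowerSeries.isUnit_iff_constantCoeff, isUnit_iff_ne_zero, not_not,
      hgc, if_neg hi.ne, if_pos hi, zero_add, ← PowerSeries.coeff_zero_eq_constantCoeff_apply, hcc, Finsupp.single_zero,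
      MvPowerSeries.coeff_zero_eq_constantCoeff_apply]
    exact ha0 i hi
  have hmapne : (e (X 0 ^ o + ∑ i ∈ Finset.range o, a i * X 0 ^ i)).map (IsLocalRing.residue A) ≠ 0 := by
    intro h0
    have h1 := congrArg (PowerSeries.coeff o) h0
    rw [PowerSeries.coeff_map, htop, map_one, map_zero] at h1
    exact one_ne_zero h1
  have horder : ((e (X 0 ^ o + ∑ i ∈ Finset.range o, a i * X 0 ^ i)).map (IsLocalRing.residue A)).order = o := by
    rw [PowerSeries.order_eq_nat]
    refine ⟨?_, fun i hi => ?_⟩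
    · rw [PowerSeries.coeff_map, htop, map_one]
      exact one_ne_zero
    · rw [PowerSeries.coeff_map, IsLocalRing.residue_eq_zero_iff]
      exact hmem i hi
  have H : (e (X 0 ^ o + ∑ i ∈ Finset.range o, a i * X 0 ^ i)).IsWeierstrassDivisor :=
    PowerSeries.IsWeierstrassDivisor.of_map_ne_zero hmapne
  have hres : ((e (X 0 ^ o + ∑ i ∈ Finset.range o, a i * X 0 ^ i)).map
      (Ideal.Quotient.mk (IsLocalRing.maximalIdeal A))).order.toNat = o := by
    show ((e (X 0 ^ o + ∑ i ∈ Finset.range o, a i * X 0 ^ i)).map (IsLocalRing.residue A)).order.toNat = o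
    rw [horder]
    rfl
  have hdeg : (Polynomial.C (PowerSeries.constantCoeff (e c))).degree <
      (((e (X 0 ^ o + ∑ i ∈ Finset.range o, a i * X 0 ^ i)).map
        (Ideal.Quotient.mk (IsLocalRing.maximalIdeal A))).order.toNat : WithBot ℕ) := by
    rw [hres]
    exact lt_of_le_of_lt Polynomial.degree_C_le (by exact_mod_cast ho)
  have heq : e (X 0 ^ o + ∑ i ∈ Finset.range o, a i * X 0 ^ i) * e q =
      ((Polynomial.C (PowerSeries.constantCoeff (e c)) : Polynomial A) : PowerSeries A) := by
    rw [Polynomial.coe_C, ← hC c hc, hq, map_mul]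
  obtain ⟨-, hr⟩ := PowerSeries.IsWeierstrassDivisorAt.eq_zero_of_mul_eq H hdeg heq
  have hec : e c = 0 := by
    rw [hC c hc, Polynomial.C_eq_zero.mp hr, map_zero]
  exact (map_eq_zero_iff e e.injective).mp hec

end TameFourTupleDrop

end Summit.ResolutionOfSingularities.ResolutionOfSingularities.Theorems
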